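import Summits.HubbardSuperconductivity.HubbardSuperconductivity.Theorems.BcsKacWindowCoherenceWindowLROSharpTransfer
import Literature.MathematicalPhysics.QuantumLattice.FreeFermiGasNoThermalPairFieldLRO
import Literature.MathematicalPhysics.QuantumLattice.FinDimSpectrumSectorGibbsLimit

/-!
# Route `BcsKacWindow`, crux `CoherenceWindowLRO` — the ENERGETIC (Kac / mean-field) transfer

Helper file for the crux item `stmt-HubbardSuperconductivity-1319` (`CoherenceWindowLRO`, rank 2 of
route `BcsKacWindow`), line `birth`. The companion files `…GroundStateTransfer`, `…SharpTransfer`,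
`…TransferNecessity` reduce the crux to SPECTRAL data on the window tori (a gapped, weakly coupled
low-energy subspace with `d`-wave order). This file records the cheaper, purely ENERGETIC reduction —
the finite-dimensional form of the mechanism behind the route's card name ("BCS is a Kac limit"):
pair order in EVERY sector ground state follows from a comparison of two sector ground ENERGIES, by
the variational principle alone. Notation: `H = hubbardTorus 2 L 1 U`, `K = szSector N 0`,
`e = minEnergyOn H K`, `B = Δ_d†Δ_d = (pairField dWaveFormFactor L)ᴴ * pairField dWaveFormFactor L`.

* `re_quadForm_ge_of_energyShift` — **first-order (Hellmann–Feynman) transfer**: an operator lower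
  bound `A + gB ≥ e + g·m` on the sector (`g > 0`) gives `Re⟨ψ,Bψ⟩ ≥ m` for every unit `ψ` of
  `A`-energy `≤ e`, in particular for EVERY sector ground state;
* `exists_energyShift_of_groundOrder` — **converse**: order `≥ m` of `B ≥ 0` on every unit sector
  ground vector of a Hermitian sector-preserving `A`, plus a ceiling `M` on the sector, give
  `A + gB ≥ e + g·m/4` on the sector for some `g > 0` (from the gap above the ground multiplet);
* `coherenceWindowLRO_of_pairSusceptibility`, `pairSusceptibility_of_coherenceWindowLRO`,
  `coherenceWindowLRO_iff_pairSusceptibility` — **the crux is EQUIVALENT to a first-order pair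
  susceptibility bound on the sector ground energies of the window tori**: for some `g > 0` (per
  torus), `H + g·Δ_d†Δ_d ≥ e + g·c₀Δ(U)²L⁴` on `K`;
* `coherenceWindowLRO_of_condensationEnergy` — **the crux from a UNIFORM ground-energy comparison**
  (the recommended energetic export of a weak-coupling construction): with ONE coupling `g > 0`,
  `minEnergyOn (H + (g/L²)Δ_d†Δ_d) K ≥ minEnergyOn H K + g·c₀Δ(U)²L²` on every window torus implies
  `CoherenceWindowLRO` — if weakening the `d_{x²-y²}` BCS channel by the Kac-normalised repulsion
  `(g/L²)Δ_d†Δ_d` costs at least the condensation energy `g·c₀Δ(U)²` per site, EVERY sector ground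
  state carries `d`-wave pair order `≥ c₀Δ(U)²L⁴`; no gap, subspace or uniqueness is needed.

Reading (not used in the proofs). The uniform hypothesis is a genuine strengthening of the crux (the
crux only controls the right-derivative of `g ↦ minEnergyOn (H + (g/L²)B) K` at `g = 0`; concavity
gives nothing at finite `g`), and it is what a BCS-type construction computes (condensation energy
`≈ N(0)Δ²L²/2`, `d`-wave channel neutralised for `g ≳ g_eff(U) ~ U²`, so `c₀ ≈ N(0)/(2g)`). Both
energies are needed to absolute precision `o(Δ(U)²) = o(e^{-2κ/U²})` per site — below
`Literature.Barriers.HubbardSuperconductivity.WeakCouplingCeiling`, the programme of item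
`stmt-HubbardSuperconductivity-2010`; the hypothesis is NOT claimed here.

Sources: Griffiths, J. Math. Phys. 5 (1964) 1215, §II and Tasaki (2020) §2.2, §3.4 (order from energy
shifts, variational principle); Kato (1966) II-§5.1 (first-order perturbation of a degenerate
eigenvalue). Tree API: `exists_gap_above_groundMultiplet`, `minEnergyOn_le_rayleigh_of_mem`,
`isHermitian_add_ofReal_smul`, `exists_mem_add_orth`, `re_quadForm_add`, `re_quadForm_sub_le`, `re_star_dotProduct_add_self_of_orth`,
`re_expect_pairField_dWave_conjTranspose_mul_le_yang`, `window_side_eventually_large`. Folklore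
finite-dimensional linear algebra; no definition and no named fact is introduced.
-/

set_option linter.dupNamespace false

namespace Summit.HubbardSuperconductivity.HubbardSuperconductivity.Theorems.BcsKacWindow

open Matrix Literature.MathematicalPhysics.QuantumLattice
open Literature.MathematicalPhysics.QuantumLattice.EigenvalueContinuation
open Summit.HubbardSuperconductivity.HubbardSuperconductivity.Theses.BcsKacWindow
open scoped ComplexOrder

section LinearAlgebra

variable {ι : Type*} [Fintype ι]

/-- The quadratic form of a real-coupling perturbation:
`Re⟨v, (A + g B) v⟩ = Re⟨v, A v⟩ + g · Re⟨v, B v⟩`. [folklore] -/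
theorem re_quadForm_add_real_smul (A B : Matrix ι ι ℂ) (g : ℝ) (v : ι → ℂ) :
    (star v ⬝ᵥ (A + (g : ℂ) • B) *ᵥ v).re =
      (star v ⬝ᵥ A *ᵥ v).re + g * (star v ⬝ᵥ B *ᵥ v).re := by
  rw [add_mulVec, smul_mulVec, dotProduct_add, dotProduct_smul, Complex.add_re, smul_eq_mul,
    Complex.re_ofReal_mul]

/-- **First-order (Hellmann–Feynman) transfer of order from an energy shift.** If at the unit vector
`ψ` the perturbed form is bounded below, `(e + g·m)‖ψ‖² ≤ Re⟨ψ, (A + gB)ψ⟩` with `g > 0`, while the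
unperturbed energy of `ψ` is at most `e`, then `Re⟨ψ, Bψ⟩ ≥ m` (for a sector ground state the energy
IS `e = minEnergyOn A K`: order in EVERY ground state, degenerate or not). Griffiths (1964) §II. [folklore] -/
theorem re_quadForm_ge_of_energyShift {A B : Matrix ι ι ℂ} {ψ : ι → ℂ} {e g m : ℝ} (hg : 0 < g)
    (hψ1 : star ψ ⬝ᵥ ψ = 1)
    (hlow : (e + g * m) * (star ψ ⬝ᵥ ψ).re ≤ (star ψ ⬝ᵥ (A + (g : ℂ) • B) *ᵥ ψ).re)
    (hE : (star ψ ⬝ᵥ A *ᵥ ψ).re ≤ e) :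
    m ≤ (star ψ ⬝ᵥ B *ᵥ ψ).re := by
  rw [re_quadForm_add_real_smul, hψ1, Complex.one_re, mul_one] at hlow
  have h : g * m ≤ g * (star ψ ⬝ᵥ B *ᵥ ψ).re := by linarith
  exact le_of_mul_le_mul_left h hg

/-- Homogeneity: an order bound stated on UNIT sector eigenvectors of `A` (eigenvalue `e`) holds in
the form `m‖w‖² ≤ Re⟨w, B w⟩` on all of them. [folklore] -/
theorem re_quadForm_ge_mul_of_unit {A B : Matrix ι ι ℂ} {K : Submodule ℂ (ι → ℂ)} {e m : ℝ}
    (hunit : ∀ ψ ∈ K, star ψ ⬝ᵥ ψ = 1 → A *ᵥ ψ = (e : ℂ) • ψ → m ≤ (star ψ ⬝ᵥ B *ᵥ ψ).re)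
    {w : ι → ℂ} (hwK : w ∈ K) (hw : A *ᵥ w = (e : ℂ) • w) :
    m * (star w ⬝ᵥ w).re ≤ (star w ⬝ᵥ B *ᵥ w).re := by
  by_cases hw0 : w = 0
  · subst hw0
    simp
  obtain ⟨c, hc, hcc, hc1⟩ := exists_normalize hw0
  have hcw : A *ᵥ ((c : ℂ) • w) = (e : ℂ) • ((c : ℂ) • w) := by rw [mulVec_smul, hw, smul_comm]
  have h := hunit ((c : ℂ) • w) (K.smul_mem _ hwK) hc1 hcw
  rw [mulVec_smul, star_real_smul_dotProduct_real_smul, Complex.re_ofReal_mul] at h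
  have hpos := re_star_dotProduct_self_pos hw0
  calc m * (star w ⬝ᵥ w).re ≤ c * c * (star w ⬝ᵥ B *ᵥ w).re * (star w ⬝ᵥ w).re :=
        mul_le_mul_of_nonneg_right h hpos.le
    _ = (star w ⬝ᵥ B *ᵥ w).re * (c * c * (star w ⬝ᵥ w).re) := by ring
    _ = (star w ⬝ᵥ B *ᵥ w).re := by rw [hcc, mul_one]

/-- **Converse: an energy shift from order on the ground multiplet.** Let `A` be Hermitian and
preserve the sector `K`, `e = minEnergyOn A K`, `B ≥ 0` with a ceiling `Re⟨q, Bq⟩ ≤ M‖q‖²` on `K`,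
and suppose every unit sector ground vector (`ψ ∈ K`, `Aψ = eψ`) has `Re⟨ψ, Bψ⟩ ≥ m ≥ 0`. Then for
some `g > 0`, `Re⟨χ, (A + gB)χ⟩ ≥ (e + g·m/4)‖χ‖²` for all `χ ∈ K`. (With `γ > 0` the gap above the
ground multiplet `W` and `χ = w + q`, `w ∈ W`, `q ⊥ W`: `Re⟨χ,Aχ⟩ ≥ e‖χ‖² + γ‖q‖²` and, `B ≥ 0`,
`Re⟨χ,Bχ⟩ ≥ ½Re⟨w,Bw⟩ - Re⟨q,Bq⟩ ≥ (m/2)‖w‖² - M‖q‖²`; take `g := γ/(m/4 + M + 1)`.)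
Kato (1966) II-§5.1; folklore in this variational form. [folklore] -/
theorem exists_energyShift_of_groundOrder [DecidableEq ι] {A B : Matrix ι ι ℂ} (hA : A.IsHermitian)
    (hB : B.PosSemidef) (K : Submodule ℂ (ι → ℂ)) (hKA : ∀ v ∈ K, A *ᵥ v ∈ K) {m M : ℝ}
    (hm : 0 ≤ m) (hM : 0 ≤ M)
    (hord : ∀ ψ ∈ K, star ψ ⬝ᵥ ψ = 1 → A *ᵥ ψ = ((A.minEnergyOn K : ℝ) : ℂ) • ψ →
      m ≤ (star ψ ⬝ᵥ B *ᵥ ψ).re)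
    (hceil : ∀ q ∈ K, (star q ⬝ᵥ B *ᵥ q).re ≤ M * (star q ⬝ᵥ q).re) :
    ∃ g : ℝ, 0 < g ∧ ∀ χ ∈ K,
      (A.minEnergyOn K + g * (m / 4)) * (star χ ⬝ᵥ χ).re ≤ (star χ ⬝ᵥ (A + (g : ℂ) • B) *ᵥ χ).re := by
  classical
  set e : ℝ := A.minEnergyOn K with he_def
  -- the ground multiplet and the gap above it
  set W : Submodule ℂ (ι → ℂ) := K ⊓ Module.End.eigenspace (Matrix.toLin' A) ((e : ℝ) : ℂ)
    with hW_def
  obtain ⟨γ, hγ, hgap⟩ := exists_gap_above_groundMultiplet hA K hKA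
  -- the coupling
  have hden : 0 < m / 4 + M + 1 := by positivity
  refine ⟨γ / (m / 4 + M + 1), div_pos hγ hden, fun χ hχK => ?_⟩
  set g : ℝ := γ / (m / 4 + M + 1) with hg_def
  have hg0 : 0 ≤ g := (div_pos hγ hden).le
  have hgle : g * (m / 4 + M) ≤ γ := by
    rw [hg_def, div_mul_eq_mul_div, div_le_iff₀ hden]
    nlinarith [hγ.le]
  -- the orthogonal splitting `χ = w + q`, `w ∈ W`, `q ∈ K ∩ W^⊥`
  obtain ⟨w, hwW, q, hχ, hqorth⟩ := exists_mem_add_orth W χ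
  obtain ⟨hwK, hAw⟩ := (mem_inf_eigenspace_toLin'_iff A K e w).1 hwW
  have hqK : q ∈ K := by
    have : q = χ - w := by rw [hχ, add_sub_cancel_left]
    rw [this]
    exact K.sub_mem hχK hwK
  have hwq : star w ⬝ᵥ q = 0 := hqorth w hwW
  have hqw : star q ⬝ᵥ w = 0 := by rw [star_dotProduct, hwq, star_zero]
  -- norms
  set X : ℝ := (star w ⬝ᵥ w).re with hX
  set Y : ℝ := (star q ⬝ᵥ q).re with hY
  have hX0 : 0 ≤ X := by rw [hX, ← eucNorm_sq]; positivity
  have hY0 : 0 ≤ Y := by rw [hY, ← eucNorm_sq]; positivity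
  have hnorm : (star χ ⬝ᵥ χ).re = X + Y := by
    rw [hχ, re_star_dotProduct_add_self_of_orth hwq]
  -- the `A`-form: `Re⟨χ,Aχ⟩ ≥ e X + (e + γ) Y`
  have hAww : (star w ⬝ᵥ A *ᵥ w).re = e * X := by
    rw [hAw, dotProduct_smul, smul_eq_mul, Complex.re_ofReal_mul]
  have hAqw : (star q ⬝ᵥ A *ᵥ w).re = 0 := by
    rw [hAw, dotProduct_smul, hqw, smul_zero, Complex.zero_re]
  have hAqq : (e + γ) * Y ≤ (star q ⬝ᵥ A *ᵥ q).re := by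
    refine hgap q hqK fun ψ hψK hψ => hqorth ψ ?_
    exact (mem_inf_eigenspace_toLin'_iff A K e ψ).2 ⟨hψK, hψ⟩
  have hAχ : e * X + (e + γ) * Y ≤ (star χ ⬝ᵥ A *ᵥ χ).re := by
    rw [hχ, re_quadForm_add hA w q, hAww, hAqw]
    linarith
  -- the `B`-form: `Re⟨χ,Bχ⟩ ≥ (m/2) X - M Y`
  have hBw : m * X ≤ (star w ⬝ᵥ B *ᵥ w).re :=
    re_quadForm_ge_mul_of_unit (A := A) (K := K) (e := e) hord hwK hAw
  have hBq : (star q ⬝ᵥ B *ᵥ q).re ≤ M * Y := hceil q hqK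
  have hpar : (star w ⬝ᵥ B *ᵥ w).re ≤ 2 * (star χ ⬝ᵥ B *ᵥ χ).re + 2 * (star q ⬝ᵥ B *ᵥ q).re := by
    have h := re_quadForm_sub_le hB χ q
    have hw' : χ - q = w := by rw [hχ, add_sub_cancel_right]
    rwa [hw'] at h
  have hBχ : m / 2 * X - M * Y ≤ (star χ ⬝ᵥ B *ᵥ χ).re := by linarith
  -- assemble
  rw [re_quadForm_add_real_smul, hnorm]
  have hgB : g * (m / 2 * X - M * Y) ≤ g * (star χ ⬝ᵥ B *ᵥ χ).re :=
    mul_le_mul_of_nonneg_left hBχ hg0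
  have hkey : (e + g * (m / 4)) * (X + Y) ≤ e * X + (e + γ) * Y + g * (m / 2 * X - M * Y) := by
    have h1 : g * (m / 4) * Y + g * M * Y ≤ γ * Y := by
      nlinarith [mul_le_mul_of_nonneg_right hgle hY0]
    nlinarith [mul_nonneg hg0 (mul_nonneg hm hX0)]
  linarith

end LinearAlgebra

/-! ### The crux and the pair susceptibility of the sector ground energy -/

/-- **`CoherenceWindowLRO` from a first-order pair-susceptibility bound on the window tori.**
If, with the crux's constants and pins, every window torus (`δ ∈ [a,b]`, `U ∈ (0,U₁(s))`, even `L`,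
`s₀ ≤ Δ(U)L ≤ s`) admits a coupling `g > 0` with the operator lower bound on the sector
`K = szSector N 0`: `H + g·Δ_d†Δ_d ≥ minEnergyOn H K + g·c₀Δ(U)²L⁴` (`H = hubbardTorus 2 L 1 U`),
then `CoherenceWindowLRO`: a unit sector ground state has energy exactly `minEnergyOn H K`, so
`re_quadForm_ge_of_energyShift` gives `Re⟨ψ, Δ_d†Δ_d ψ⟩ ≥ c₀Δ(U)²L⁴`. [folklore] -/
theorem coherenceWindowLRO_of_pairSusceptibility :
    (∃ (a b κ₁ κ₂ c₀ s₀ : ℝ) (Δ : ℝ → ℝ), 0 < a ∧ a < b ∧ b < 1 / 2 ∧ 0 < κ₁ ∧ κ₁ ≤ κ₂ ∧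
      0 < c₀ ∧ 0 < s₀ ∧
      (∀ U : ℝ, 0 < U → Real.exp (-(κ₂ / U ^ 2)) ≤ Δ U ∧ Δ U ≤ Real.exp (-(κ₁ / U ^ 2))) ∧
      ∀ s : ℝ, s₀ ≤ s → ∃ U₁ : ℝ, 0 < U₁ ∧ ∀ δ ∈ Set.Icc a b, ∀ U ∈ Set.Ioo (0 : ℝ) U₁,
        ∀ (L : ℕ) [NeZero L], Even L → s₀ ≤ Δ U * L → Δ U * L ≤ s →
          ∃ g : ℝ, 0 < g ∧ ∀ χ ∈ szSector (Λ := FermionTorus 2 L) (2 * ⌊(1 - δ) * (L : ℝ) ^ 2 / 2⌋₊) 0,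
            ((hubbardTorus 2 L 1 U).minEnergyOn (szSector (2 * ⌊(1 - δ) * (L : ℝ) ^ 2 / 2⌋₊) 0) +
                g * (c₀ * Δ U ^ 2 * (L : ℝ) ^ 4)) * (star χ ⬝ᵥ χ).re ≤
              (star χ ⬝ᵥ (hubbardTorus 2 L 1 U +
                (g : ℂ) • ((pairField dWaveFormFactor L)ᴴ * pairField dWaveFormFactor L)) *ᵥ χ).re) →
    CoherenceWindowLRO := by
  intro h
  obtain ⟨a, b, κ₁, κ₂, c₀, s₀, Δ, ha, hab, hb, hκ₁, hκ₁₂, hc₀, hs₀, hpin, hS⟩ := h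
  refine ⟨a, b, κ₁, κ₂, c₀, s₀, Δ, ha, hab, hb, hκ₁, hκ₁₂, hc₀, hs₀, hpin, fun s hs => ?_⟩
  obtain ⟨U₁, hU₁, hwin⟩ := hS s hs
  refine ⟨U₁, hU₁, ?_⟩
  intro δ hδ U hU L _ hE hlo hhi ψ hψ1 hgs
  obtain ⟨g, hg, hop⟩ := hwin δ hδ U hU L hE hlo hhi
  obtain ⟨hψK, -, hHψ⟩ := hgs
  have hE : (star ψ ⬝ᵥ hubbardTorus 2 L 1 U *ᵥ ψ).re ≤
      (hubbardTorus 2 L 1 U).minEnergyOn (szSector (2 * ⌊(1 - δ) * (L : ℝ) ^ 2 / 2⌋₊) 0) := by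
    rw [hHψ, dotProduct_smul, hψ1, smul_eq_mul, mul_one, Complex.ofReal_re]
  have hm := re_quadForm_ge_of_energyShift hg hψ1 (hop ψ hψK) hE
  have hLpos : (0 : ℝ) < (L : ℝ) := Nat.cast_pos.mpr (Nat.pos_of_ne_zero (NeZero.ne L))
  rw [le_div_iff₀ (by positivity)]
  simpa only [expect] using hm

/-- **Necessity of the pair-susceptibility bound.** `CoherenceWindowLRO` implies the hypothesis of
`coherenceWindowLRO_of_pairSusceptibility` with constant `c₀/4` (same `a, b, κ₁, κ₂, s₀, Δ`; `U₁(s)`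
shrunk so that `L ≥ 3` in the window, `window_side_eventually_large`): on each window torus apply
`exists_energyShift_of_groundOrder` on the (invariant) sector, with the crux as the order hypothesis
on unit ground vectors and Yang's ceiling `Re⟨q, Δ_d†Δ_d q⟩ ≤ 2N(2L²-N+2)‖q‖²`
(`re_expect_pairField_dWave_conjTranspose_mul_le_yang`). [folklore] -/
theorem pairSusceptibility_of_coherenceWindowLRO : CoherenceWindowLRO →
    (∃ (a b κ₁ κ₂ c₀ s₀ : ℝ) (Δ : ℝ → ℝ), 0 < a ∧ a < b ∧ b < 1 / 2 ∧ 0 < κ₁ ∧ κ₁ ≤ κ₂ ∧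
      0 < c₀ ∧ 0 < s₀ ∧
      (∀ U : ℝ, 0 < U → Real.exp (-(κ₂ / U ^ 2)) ≤ Δ U ∧ Δ U ≤ Real.exp (-(κ₁ / U ^ 2))) ∧
      ∀ s : ℝ, s₀ ≤ s → ∃ U₁ : ℝ, 0 < U₁ ∧ ∀ δ ∈ Set.Icc a b, ∀ U ∈ Set.Ioo (0 : ℝ) U₁,
        ∀ (L : ℕ) [NeZero L], Even L → s₀ ≤ Δ U * L → Δ U * L ≤ s →
          ∃ g : ℝ, 0 < g ∧ ∀ χ ∈ szSector (Λ := FermionTorus 2 L) (2 * ⌊(1 - δ) * (L : ℝ) ^ 2 / 2⌋₊) 0,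
            ((hubbardTorus 2 L 1 U).minEnergyOn (szSector (2 * ⌊(1 - δ) * (L : ℝ) ^ 2 / 2⌋₊) 0) +
                g * (c₀ * Δ U ^ 2 * (L : ℝ) ^ 4)) * (star χ ⬝ᵥ χ).re ≤
              (star χ ⬝ᵥ (hubbardTorus 2 L 1 U +
                (g : ℂ) • ((pairField dWaveFormFactor L)ᴴ * pairField dWaveFormFactor L)) *ᵥ χ).re) := by
  intro h
  obtain ⟨a, b, κ₁, κ₂, c₀, s₀, Δ, ha, hab, hb, hκ₁, hκ₁₂, hc₀, hs₀, hpin, hS⟩ := h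
  refine ⟨a, b, κ₁, κ₂, c₀ / 4, s₀, Δ, ha, hab, hb, hκ₁, hκ₁₂, by positivity, hs₀, hpin,
    fun s hs => ?_⟩
  obtain ⟨U₁, hU₁, hwin⟩ := hS s hs
  clear hS
  -- shrink `U₁` so that the window forces `L ≥ 3`
  obtain ⟨U₂, hU₂, hside⟩ :=
    window_side_eventually_large hκ₁ hs₀ (fun U hU => (hpin U hU).2) (2 : ℝ)
  refine ⟨min U₁ U₂, lt_min hU₁ hU₂, ?_⟩
  intro δ hδ U hU L _ hE hlo hhi
  have hUpos : 0 < U := hU.1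
  have hU₁' : U ∈ Set.Ioo (0 : ℝ) U₁ := ⟨hU.1, lt_of_lt_of_le hU.2 (min_le_left _ _)⟩
  have hL2 : (2 : ℝ) < L := hside U hUpos (lt_of_lt_of_le hU.2 (min_le_right _ _)) L hlo
  clear hside
  have hL3 : 3 ≤ L := by
    have : (2 : ℕ) < L := by exact_mod_cast hL2
    omega
  have hcrux := hwin δ hδ U hU₁' L hE hlo hhi
  clear hwin
  -- the data of `exists_energyShift_of_groundOrder`
  have hHh : (hubbardTorus 2 L 1 U).IsHermitian :=
    hubbardTorus_isHermitian (hamiltonian_isHermitian_and_commute_holds _) 1 U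
  have hBp : ((pairField dWaveFormFactor L)ᴴ * pairField dWaveFormFactor L).PosSemidef :=
    pairField_conjTranspose_mul_self_posSemidef dWaveFormFactor L
  have hKinv : ∀ v ∈ szSector (Λ := FermionTorus 2 L) (2 * ⌊(1 - δ) * (L : ℝ) ^ 2 / 2⌋₊) 0,
      hubbardTorus 2 L 1 U *ᵥ v ∈
        szSector (Λ := FermionTorus 2 L) (2 * ⌊(1 - δ) * (L : ℝ) ^ 2 / 2⌋₊) 0 :=
    fun v hv => hubbardTorus_mulVec_mem_szSector 1 U hv
  have hΔpos : 0 < Δ U := lt_of_lt_of_le (Real.exp_pos _) (hpin U hUpos).1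
  have hLpos : (0 : ℝ) < (L : ℝ) := by linarith
  have hL4 : (0 : ℝ) < (L : ℝ) ^ 4 := by positivity
  have hm0 : 0 ≤ c₀ * Δ U ^ 2 * (L : ℝ) ^ 4 := by positivity
  -- the order on unit ground vectors: the crux
  have hord : ∀ ψ ∈ szSector (Λ := FermionTorus 2 L) (2 * ⌊(1 - δ) * (L : ℝ) ^ 2 / 2⌋₊) 0,
      star ψ ⬝ᵥ ψ = 1 →
        hubbardTorus 2 L 1 U *ᵥ ψ = (((hubbardTorus 2 L 1 U).minEnergyOn
          (szSector (2 * ⌊(1 - δ) * (L : ℝ) ^ 2 / 2⌋₊) 0) : ℝ) : ℂ) • ψ →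
          c₀ * Δ U ^ 2 * (L : ℝ) ^ 4 ≤
            (star ψ ⬝ᵥ ((pairField dWaveFormFactor L)ᴴ * pairField dWaveFormFactor L) *ᵥ ψ).re := by
    intro ψ hψK hψ1 hHψ
    have hψ0 : ψ ≠ 0 := by
      rintro rfl
      simp at hψ1
    have h := hcrux ψ hψ1 ⟨hψK, hψ0, hHψ⟩
    rw [le_div_iff₀ hL4] at h
    simpa only [expect] using h
  -- Yang's ceiling on the sector
  have hNeven : Even (2 * ⌊(1 - δ) * (L : ℝ) ^ 2 / 2⌋₊) := even_two_mul _
  have h1δ : 0 ≤ 1 - δ := by linarith [hδ.2, hb]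
  have hfl : (⌊(1 - δ) * (L : ℝ) ^ 2 / 2⌋₊ : ℝ) ≤ (1 - δ) * (L : ℝ) ^ 2 / 2 :=
    Nat.floor_le (by positivity)
  have hδ0 : 0 ≤ δ := le_trans ha.le hδ.1
  have hNle : ((2 * ⌊(1 - δ) * (L : ℝ) ^ 2 / 2⌋₊ : ℕ) : ℝ) ≤ (L : ℝ) ^ 2 := by
    push_cast
    nlinarith [sq_nonneg (L : ℝ)]
  have hN2 : 2 * ⌊(1 - δ) * (L : ℝ) ^ 2 / 2⌋₊ ≤ 2 * L ^ 2 := by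
    have h' : ((2 * ⌊(1 - δ) * (L : ℝ) ^ 2 / 2⌋₊ : ℕ) : ℝ) ≤ ((2 * L ^ 2 : ℕ) : ℝ) := by
      push_cast at hNle ⊢
      nlinarith [sq_nonneg (L : ℝ)]
    exact_mod_cast h'
  set Nr : ℝ := ((2 * ⌊(1 - δ) * (L : ℝ) ^ 2 / 2⌋₊ : ℕ) : ℝ) with hNr
  have hNr0 : 0 ≤ Nr := Nat.cast_nonneg _
  have hM0 : 0 ≤ 2 * Nr * (2 * (L : ℝ) ^ 2 - Nr + 2) :=
    mul_nonneg (mul_nonneg two_pos.le hNr0) (by linarith)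
  have hceil : ∀ q ∈ szSector (Λ := FermionTorus 2 L) (2 * ⌊(1 - δ) * (L : ℝ) ^ 2 / 2⌋₊) 0,
      (star q ⬝ᵥ ((pairField dWaveFormFactor L)ᴴ * pairField dWaveFormFactor L) *ᵥ q).re ≤
        (2 * Nr * (2 * (L : ℝ) ^ 2 - Nr + 2)) * (star q ⬝ᵥ q).re := by
    intro q hq
    have hy := re_expect_pairField_dWave_conjTranspose_mul_le_yang L hL3 hNeven hN2
      ((mem_szSector_iff _ 0 q).1 hq).1
    simpa only [expect] using hy
  -- the abstract converse
  obtain ⟨g, hg, hop⟩ := exists_energyShift_of_groundOrder hHh hBp _ hKinv hm0 hM0 hord hceil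
  refine ⟨g, hg, fun χ hχ => ?_⟩
  have h := hop χ hχ
  have hc : c₀ / 4 * Δ U ^ 2 * (L : ℝ) ^ 4 = c₀ * Δ U ^ 2 * (L : ℝ) ^ 4 / 4 := by ring
  rw [hc]
  exact h

/-- **`CoherenceWindowLRO` ⟺ the first-order pair susceptibility of the sector ground energy**:
"on every coherence-window torus, for some `g > 0`, adding the reduced `d_{x²-y²}` pair repulsion
`g·Δ_d†Δ_d` to `hubbardTorus 2 L 1 U` lifts the whole sector `szSector N 0` to energy
`≥ minEnergyOn H K + g·c₀Δ(U)²L⁴`" (a lower bound on the right-derivative at `g = 0` of the sector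
ground energy of `H + g·Δ_d†Δ_d`; the every-ground-state quantifier is absorbed). [folklore] -/
theorem coherenceWindowLRO_iff_pairSusceptibility : CoherenceWindowLRO ↔
    (∃ (a b κ₁ κ₂ c₀ s₀ : ℝ) (Δ : ℝ → ℝ), 0 < a ∧ a < b ∧ b < 1 / 2 ∧ 0 < κ₁ ∧ κ₁ ≤ κ₂ ∧
      0 < c₀ ∧ 0 < s₀ ∧
      (∀ U : ℝ, 0 < U → Real.exp (-(κ₂ / U ^ 2)) ≤ Δ U ∧ Δ U ≤ Real.exp (-(κ₁ / U ^ 2))) ∧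
      ∀ s : ℝ, s₀ ≤ s → ∃ U₁ : ℝ, 0 < U₁ ∧ ∀ δ ∈ Set.Icc a b, ∀ U ∈ Set.Ioo (0 : ℝ) U₁,
        ∀ (L : ℕ) [NeZero L], Even L → s₀ ≤ Δ U * L → Δ U * L ≤ s →
          ∃ g : ℝ, 0 < g ∧ ∀ χ ∈ szSector (Λ := FermionTorus 2 L) (2 * ⌊(1 - δ) * (L : ℝ) ^ 2 / 2⌋₊) 0,
            ((hubbardTorus 2 L 1 U).minEnergyOn (szSector (2 * ⌊(1 - δ) * (L : ℝ) ^ 2 / 2⌋₊) 0) +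
                g * (c₀ * Δ U ^ 2 * (L : ℝ) ^ 4)) * (star χ ⬝ᵥ χ).re ≤
              (star χ ⬝ᵥ (hubbardTorus 2 L 1 U +
                (g : ℂ) • ((pairField dWaveFormFactor L)ᴴ * pairField dWaveFormFactor L)) *ᵥ χ).re) :=
  ⟨pairSusceptibility_of_coherenceWindowLRO, coherenceWindowLRO_of_pairSusceptibility⟩

/-! ### The crux from a uniform ground-energy comparison (the energetic export) -/

/-- **`CoherenceWindowLRO` from the condensation-energy comparison (Kac form).** If, with the crux's
constants and pins and ONE coupling `g > 0`, on every window torus the sector ground energies of the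
Hubbard torus `H` and of `H` with its `d_{x²-y²}` BCS channel weakened by the Kac-normalised repulsion
`(g/L²)·Δ_d†Δ_d` compare as `minEnergyOn (H + (g/L²)Δ_d†Δ_d) K ≥ minEnergyOn H K + g·c₀Δ(U)²L²`
(the shift is the condensation energy `g·c₀Δ(U)²` per site), then `CoherenceWindowLRO`: for a unit
sector ground state `ψ` the variational principle gives `minEnergyOn (H + (g/L²)B) K ≤
Re⟨ψ,(H + (g/L²)B)ψ⟩ = minEnergyOn H K + (g/L²)Re⟨ψ,Bψ⟩`, whence `Re⟨ψ, Δ_d†Δ_d ψ⟩ ≥ c₀Δ(U)²L⁴` for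
EVERY sector ground state — no gap, uniqueness or low-energy subspace. The hypothesis (two-sided
ground-energy asymptotics at absolute precision `o(Δ(U)²)` per site, below `WeakCouplingCeiling`) is
NOT claimed here. Griffiths (1964) §II; folklore. [folklore] -/
theorem coherenceWindowLRO_of_condensationEnergy :
    (∃ (a b κ₁ κ₂ c₀ s₀ g : ℝ) (Δ : ℝ → ℝ), 0 < a ∧ a < b ∧ b < 1 / 2 ∧ 0 < κ₁ ∧ κ₁ ≤ κ₂ ∧
      0 < c₀ ∧ 0 < s₀ ∧ 0 < g ∧
      (∀ U : ℝ, 0 < U → Real.exp (-(κ₂ / U ^ 2)) ≤ Δ U ∧ Δ U ≤ Real.exp (-(κ₁ / U ^ 2))) ∧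
      ∀ s : ℝ, s₀ ≤ s → ∃ U₁ : ℝ, 0 < U₁ ∧ ∀ δ ∈ Set.Icc a b, ∀ U ∈ Set.Ioo (0 : ℝ) U₁,
        ∀ (L : ℕ) [NeZero L], Even L → s₀ ≤ Δ U * L → Δ U * L ≤ s →
          (hubbardTorus 2 L 1 U).minEnergyOn
              (szSector (Λ := FermionTorus 2 L) (2 * ⌊(1 - δ) * (L : ℝ) ^ 2 / 2⌋₊) 0) +
            g * c₀ * Δ U ^ 2 * (L : ℝ) ^ 2 ≤
          (hubbardTorus 2 L 1 U +
              ((g / (L : ℝ) ^ 2 : ℝ) : ℂ) • ((pairField dWaveFormFactor L)ᴴ * pairField dWaveFormFactor L)).minEnergyOn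
            (szSector (Λ := FermionTorus 2 L) (2 * ⌊(1 - δ) * (L : ℝ) ^ 2 / 2⌋₊) 0)) →
    CoherenceWindowLRO := by
  intro h
  obtain ⟨a, b, κ₁, κ₂, c₀, s₀, g, Δ, ha, hab, hb, hκ₁, hκ₁₂, hc₀, hs₀, hg, hpin, hS⟩ := h
  refine ⟨a, b, κ₁, κ₂, c₀, s₀, Δ, ha, hab, hb, hκ₁, hκ₁₂, hc₀, hs₀, hpin, fun s hs => ?_⟩
  obtain ⟨U₁, hU₁, hwin⟩ := hS s hs
  refine ⟨U₁, hU₁, ?_⟩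
  intro δ hδ U hU L _ hE hlo hhi ψ hψ1 hgs
  have hcmp := hwin δ hδ U hU L hE hlo hhi
  obtain ⟨hψK, -, hHψ⟩ := hgs
  have hHh : (hubbardTorus 2 L 1 U).IsHermitian :=
    hubbardTorus_isHermitian (hamiltonian_isHermitian_and_commute_holds _) 1 U
  have hBh : ((pairField dWaveFormFactor L)ᴴ * pairField dWaveFormFactor L).IsHermitian :=
    (pairField_conjTranspose_mul_self_posSemidef dWaveFormFactor L).1
  have hPh := isHermitian_add_ofReal_smul hHh hBh (g / (L : ℝ) ^ 2)
  -- variational principle at the ground state `ψ` for the perturbed Hamiltonian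
  have hvar := minEnergyOn_le_rayleigh_of_mem hPh
    (szSector (Λ := FermionTorus 2 L) (2 * ⌊(1 - δ) * (L : ℝ) ^ 2 / 2⌋₊) 0) hψK hψ1
  rw [re_quadForm_add_real_smul, hHψ, dotProduct_smul, hψ1, smul_eq_mul, mul_one,
    Complex.ofReal_re] at hvar
  -- arithmetic: `g c₀ Δ² L² ≤ (g/L²) Re⟨ψ,Bψ⟩`
  have hLpos : (0 : ℝ) < (L : ℝ) := Nat.cast_pos.mpr (Nat.pos_of_ne_zero (NeZero.ne L))
  have hL2 : (0 : ℝ) < (L : ℝ) ^ 2 := by positivity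
  set P : ℝ := (star ψ ⬝ᵥ ((pairField dWaveFormFactor L)ᴴ * pairField dWaveFormFactor L) *ᵥ ψ).re
    with hP
  have hkey : g * c₀ * Δ U ^ 2 * (L : ℝ) ^ 2 ≤ g / (L : ℝ) ^ 2 * P := by linarith
  have hkey' : g * (c₀ * Δ U ^ 2 * (L : ℝ) ^ 4) ≤ g * P := by
    have h2 := mul_le_mul_of_nonneg_right hkey hL2.le
    have hid : g / (L : ℝ) ^ 2 * P * (L : ℝ) ^ 2 = g * P := by field_simp
    rw [hid] at h2
    calc g * (c₀ * Δ U ^ 2 * (L : ℝ) ^ 4) = g * c₀ * Δ U ^ 2 * (L : ℝ) ^ 2 * (L : ℝ) ^ 2 := by ring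
      _ ≤ _ := h2
  rw [le_div_iff₀ (by positivity)]
  simpa only [expect] using le_of_mul_le_mul_left hkey' hg

end Summit.HubbardSuperconductivity.HubbardSuperconductivity.Theorems.BcsKacWindow
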